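import Summits.QuantumFields.GaugeBoot.DiagonalRPTorusClusterTerms
import HarnessLib

/-!
# The lonely-link reduction of a cluster term (gauge-boot, task L3(π), 1/7)

HONEST FRAMING (cell `pub-gaugeboot`, page 1 of every file): the venture produces certified bounds
on lattice expectations at stated coupling, gauge group, dimension and torus size; NOT a mass gap,
NOT a continuum limit, NOT a string tension; NOT Yang–Mills-summit-bearing (barriers
`FixedCouplingUltralocality`, `PerturbativeInvisibility`). This module is measure-theoretic
bookkeeping for the structural NEGATIVE result `DiagonalRPTorusInnerHalfNegativeEvenSUN`
(inner-half diagonal RP fails on even three-tori for `G ≅ SU(N)` at small coupling); it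
discharges nothing by itself.

## Content (torus `(ℤ/L)³`, `L ≥ 2`, any compact group `G`, continuous `ρ`)

For the pair terms `T_S(A,B) = ∫ P_A P_B ∏_{p ∈ S} g_p ∏ dU` of `DiagonalRPTorusClusterTerms`
(`g_p = e^{β Re tr ρ(U_p)} - 1`):

* `plaquetteHolonomy_update_cases` — replacing the variable of one link `ℓ` of a plaquette `p` by
  `s` turns `U_p` into `x s y` (for every `U`, with `x, y` not depending on `s`) or into `x s⁻¹ y`
  (for every `U`); the four links of a plaquette are pairwise distinct once `L ≥ 2`
  (`links_pairwise_ne`);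
* `exists_integral_gfac_update_eq` — hence the one-link Haar average `∫ g_p(U[ℓ ↦ s]) ds` is a
  constant `κ` not depending on `U` (left/right invariance of Haar measure; `κ` is
  `∫ (e^{β Re χ(s)} - 1) ds` or `∫ (e^{β Re χ(s⁻¹)} - 1) ds`);
* **`pairTerm_eq_mul_pairTerm_erase`** — the LONELY-LINK REDUCTION: if a link `ℓ` of `p ∈ S`
  lies in no other plaquette of `S` and is not a link of the Polyakov loops `P_A`, `P_B`, then
  `T_S(A,B) = κ · T_{S ∖ {p}}(A,B)` (Fubini along `ℓ`, `DiagRPSUN.integral_pi_update_of_forall`);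
* **`pairTerm_eq_zero_of_lonely`** — in particular `T_{S ∖ {p}}(A,B) = 0 ⟹ T_S(A,B) = 0`.

Elementary strong-coupling bookkeeping (cf. M. Creutz, *Quarks, gluons and lattices* (1983)
§10: a plaquette with an unshared link integrates to a constant); no definition of record, no
named fact.
-/

open MeasureTheory Complex Finset Function
open scoped ComplexOrder

namespace Summit.QuantumFields.GaugeBoot

open Literature.MathematicalPhysics.QuantumFieldTheory
open Literature.MathematicalPhysics.QuantumFieldTheory.PlaquetteLowerBound (reTr)
open Literature.RepresentationTheory.CompactGroups

noncomputable section

namespace DiagRPSUN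

open DiagRPThree DiagRPPolyakov

/-! ## One link of a plaquette -/

section Links

variable {L : ℕ} {G : Type*} [Group G]

/-- `x + e_i ≠ x` on `(ℤ/L)³` for `L ≥ 2`. -/
theorem shift_ne_self (hL : 1 < L) (x : Site 3 L) (i : Fin 3) : x.shift i ≠ x := by
  have h1 : (1 : ZMod L) ≠ 0 := fun h => by
    have := (ZMod.val_eq_zero (1 : ZMod L)).2 h
    rw [ZMod.val_one'' hL.ne'] at this
    exact one_ne_zero this
  intro h
  have h2 := congrFun h i
  simp only [Site.shift, Pi.add_apply, Pi.single_eq_same, add_eq_left] at h2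
  exact h1 h2

/-- **The four links of a plaquette are pairwise distinct** (`L ≥ 2`). -/
theorem links_pairwise_ne (hL : 1 < L) (p : Plaquette 3 L) :
    (p.1, p.2.1.1) ≠ (p.1.shift p.2.1.1, p.2.1.2) ∧ (p.1, p.2.1.1) ≠ (p.1.shift p.2.1.2, p.2.1.1) ∧
      (p.1, p.2.1.1) ≠ (p.1, p.2.1.2) ∧ (p.1.shift p.2.1.1, p.2.1.2) ≠ (p.1.shift p.2.1.2, p.2.1.1) ∧
      (p.1.shift p.2.1.1, p.2.1.2) ≠ (p.1, p.2.1.2) ∧ (p.1.shift p.2.1.2, p.2.1.1) ≠ (p.1, p.2.1.2) := by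
  have hij : p.2.1.1 ≠ p.2.1.2 := ne_of_lt p.2.2
  refine ⟨fun h => hij (congrArg Prod.snd h), fun h => ?_, fun h => hij (congrArg Prod.snd h),
    fun h => hij (congrArg Prod.snd h).symm, fun h => ?_, fun h => hij (congrArg Prod.snd h)⟩
  · exact shift_ne_self hL p.1 p.2.1.2 (congrArg Prod.fst h).symm
  · exact shift_ne_self hL p.1 p.2.1.1 (congrArg Prod.fst h)

/-- **Updating one link of a plaquette**: for a link `ℓ` of `p`, either for every configuration
`U` there are `x, y : G` (not depending on the new value `s`) with `U[ℓ ↦ s]_p = x s y` for all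
`s`, or for every `U` there are `x, y` with `U[ℓ ↦ s]_p = x s⁻¹ y` for all `s` (the orientation
is decided by the position of `ℓ` on `∂p`). -/
theorem plaquetteHolonomy_update_cases (hL : 1 < L) (p : Plaquette 3 L) {ℓ : Edge 3 L}
    (hℓ : pcnt p ℓ ≠ 0) :
    (∀ U : GaugeConfig 3 L G, ∃ x y : G, ∀ s : G,
        plaquetteHolonomy (update U ℓ s) p.1 p.2.1.1 p.2.1.2 = x * s * y) ∨
      (∀ U : GaugeConfig 3 L G, ∃ x y : G, ∀ s : G,
        plaquetteHolonomy (update U ℓ s) p.1 p.2.1.1 p.2.1.2 = x * s⁻¹ * y) := by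
  obtain ⟨h12, h13, h14, h23, h24, h34⟩ := links_pairwise_ne hL p
  have hmem := mem_linkList_of_pcnt_ne_zero hℓ
  unfold linkList at hmem
  simp only [List.mem_cons, List.not_mem_nil, or_false] at hmem
  unfold plaquetteHolonomy
  rcases hmem with rfl | rfl | rfl | rfl
  · refine Or.inl fun U => ⟨1, U (p.1.shift p.2.1.1, p.2.1.2) * (U (p.1.shift p.2.1.2, p.2.1.1))⁻¹ *
      (U (p.1, p.2.1.2))⁻¹, fun s => ?_⟩
    rw [update_self, update_of_ne h12.symm, update_of_ne h13.symm, update_of_ne h14.symm]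
    group
  · refine Or.inl fun U => ⟨U (p.1, p.2.1.1), (U (p.1.shift p.2.1.2, p.2.1.1))⁻¹ *
      (U (p.1, p.2.1.2))⁻¹, fun s => ?_⟩
    rw [update_self, update_of_ne h12, update_of_ne h23.symm, update_of_ne h24.symm]
    group
  · refine Or.inr fun U => ⟨U (p.1, p.2.1.1) * U (p.1.shift p.2.1.1, p.2.1.2), (U (p.1, p.2.1.2))⁻¹,
      fun s => ?_⟩
    rw [update_self, update_of_ne h13, update_of_ne h23, update_of_ne h34.symm]
  · refine Or.inr fun U => ⟨U (p.1, p.2.1.1) * U (p.1.shift p.2.1.1, p.2.1.2) *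
      (U (p.1.shift p.2.1.2, p.2.1.1))⁻¹, 1, fun s => ?_⟩
    rw [update_self, update_of_ne h14, update_of_ne h24, update_of_ne h34, mul_one]

end Links

/-! ## The one-link average of a plaquette factor -/

section Average

variable {L : ℕ} {N : ℕ} {G : Type*} [Group G] [TopologicalSpace G]
  [IsTopologicalGroup G] [CompactSpace G] [MeasurableSpace G] [BorelSpace G]
  (ρ : G →* Matrix (Fin N) (Fin N) ℂ) (β : ℝ)

/-- Conjugating the argument: `∫ f(Re χ(x s y)) ds = ∫ f(Re χ(s)) ds`. -/
theorem integral_comp_reTr_mul_mul (f : ℝ → ℝ) (x y : G) :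
    ∫ s, f (reTr ρ (x * s * y)) ∂haarProbability G = ∫ s, f (reTr ρ s) ∂haarProbability G := by
  have h1 : ∀ s : G, reTr ρ (x * s * y) = reTr ρ (s * (y * x)) := fun s => by
    rw [mul_assoc, reTr_mul_comm ρ x (s * y), mul_assoc]
  simp_rw [h1]
  exact integral_mul_right_eq_self (μ := haarProbability G) (fun s => f (reTr ρ s)) (y * x)

/-- Conjugating the inverted argument: `∫ f(Re χ(x s⁻¹ y)) ds = ∫ f(Re χ(s⁻¹)) ds`. -/
theorem integral_comp_reTr_mul_inv_mul (f : ℝ → ℝ) (x y : G) :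
    ∫ s, f (reTr ρ (x * s⁻¹ * y)) ∂haarProbability G =
      ∫ s, f (reTr ρ s⁻¹) ∂haarProbability G := by
  have h1 : ∀ s : G, reTr ρ (x * s⁻¹ * y) = reTr ρ ((y * x)⁻¹ * s)⁻¹ := fun s => by
    rw [mul_assoc, reTr_mul_comm ρ x (s⁻¹ * y), mul_assoc, mul_inv_rev, inv_inv]
  simp_rw [h1]
  have h := integral_mul_left_eq_self (μ := haarProbability G)
    (fun s => f (reTr ρ ((y * x)⁻¹ * s)⁻¹)) (y * x)
  simp only [inv_mul_cancel_left] at h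
  exact h.symm

/-- **The one-link average of a plaquette factor is a constant**: for a link `ℓ` of `p` there is
`κ ∈ ℝ` with `∫ g_p(U[ℓ ↦ s]) ds = κ` for EVERY configuration `U`
(`κ = ∫ (e^{β Re χ(s)} - 1) ds` or `∫ (e^{β Re χ(s⁻¹)} - 1) ds`). -/
theorem exists_integral_gfac_update_eq (hL : 1 < L) (p : Plaquette 3 L) {ℓ : Edge 3 L}
    (hℓ : pcnt p ℓ ≠ 0) :
    ∃ κ : ℝ, ∀ U : GaugeConfig 3 L G, ∫ s, gfac ρ β p (update U ℓ s) ∂haarProbability G = κ := by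
  have hg : ∀ V : GaugeConfig 3 L G, gfac ρ β p V =
      (fun r : ℝ => Real.exp (β * r) - 1) (reTr ρ (plaquetteHolonomy V p.1 p.2.1.1 p.2.1.2)) :=
    fun V => rfl
  rcases plaquetteHolonomy_update_cases (G := G) hL p hℓ with h | h
  · refine ⟨∫ s, (Real.exp (β * reTr ρ s) - 1) ∂haarProbability G, fun U => ?_⟩
    obtain ⟨x, y, hxy⟩ := h U
    simp_rw [hg, hxy]
    exact integral_comp_reTr_mul_mul ρ (fun r => Real.exp (β * r) - 1) x y
  · refine ⟨∫ s, (Real.exp (β * reTr ρ s⁻¹) - 1) ∂haarProbability G, fun U => ?_⟩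
    obtain ⟨x, y, hxy⟩ := h U
    simp_rw [hg, hxy]
    exact integral_comp_reTr_mul_inv_mul ρ (fun r => Real.exp (β * r) - 1) x y

end Average

/-! ## The lonely-link reduction -/

section Lonely

variable {L : ℕ} [NeZero L] {N : ℕ} {G : Type*} [Group G] [TopologicalSpace G]
  [IsTopologicalGroup G] [CompactSpace G] [MeasurableSpace G] [BorelSpace G]
  [SecondCountableTopology G] (ρ : G →* Matrix (Fin N) (Fin N) ℂ) (β : ℝ)

omit [NeZero L] [TopologicalSpace G] [IsTopologicalGroup G] [CompactSpace G] [MeasurableSpace G]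
  [BorelSpace G] [SecondCountableTopology G] in
/-- A Polyakov loop does not read a link off its column. -/
theorem polRe_update_of_ccnt_eq_zero (A : ZMod L × ZMod L) {ℓ : Edge 3 L} (hℓ : ccnt A ℓ = 0)
    (U : GaugeConfig 3 L G) (s : G) :
    polRe ρ 2 (update U ℓ s) (vsite A 0) = polRe ρ 2 U (vsite A 0) :=
  polRe_vsite_congr ρ A fun e he => update_of_ne (fun h => he (by rw [h]; exact hℓ)) _ _

omit [NeZero L] [TopologicalSpace G] [IsTopologicalGroup G] [CompactSpace G] [MeasurableSpace G]
  [BorelSpace G] [SecondCountableTopology G] in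
/-- A plaquette factor does not read a link off its plaquette. -/
theorem gfac_update_of_pcnt_eq_zero (q : Plaquette 3 L) {ℓ : Edge 3 L} (hℓ : pcnt q ℓ = 0)
    (U : GaugeConfig 3 L G) (s : G) : gfac ρ β q (update U ℓ s) = gfac ρ β q U := by
  obtain ⟨h1, h2, h3, h4⟩ := links_ne_of_pcnt_eq_zero hℓ
  unfold gfac
  rw [plaqRe_update_of_ne ρ q h1 h2 h3 h4]

/-- **The lonely-link reduction.** Let `p ∈ S` have a link `ℓ` lying in no other plaquette of `S`
and in neither Polyakov loop (`ccnt A ℓ = ccnt B ℓ = 0`). Then `T_S(A,B) = κ T_{S∖{p}}(A,B)` for a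
real constant `κ` (the one-link average of `g_p`, `exists_integral_gfac_update_eq`). -/
theorem pairTerm_eq_mul_pairTerm_erase (hρ : Continuous ρ) (hL : 1 < L) {S : Finset (Plaquette 3 L)}
    {p : Plaquette 3 L} (hp : p ∈ S) {ℓ : Edge 3 L} (hℓ : pcnt p ℓ ≠ 0)
    (hlone : ∀ q ∈ S, q ≠ p → pcnt q ℓ = 0) {A B : ZMod L × ZMod L} (hA : ccnt A ℓ = 0)
    (hB : ccnt B ℓ = 0) :
    ∃ κ : ℝ, pairTerm ρ β S A B = κ * pairTerm ρ β (S.erase p) A B := by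
  obtain ⟨κ, hκ⟩ := exists_integral_gfac_update_eq ρ β (G := G) hL p hℓ
  refine ⟨κ, ?_⟩
  unfold pairTerm
  rw [← integral_const_mul]
  refine integral_pi_update_of_forall (haarProbability G) ℓ
    (integrable_of_continuous_config (continuous_pairIntegrand ρ β hρ S A B)) fun U => ?_
  have hsplit : ∀ V : GaugeConfig 3 L G, ∏ q ∈ S, gfac ρ β q V =
      gfac ρ β p V * ∏ q ∈ S.erase p, gfac ρ β q V := fun V => (mul_prod_erase S _ hp).symm
  have hrest : ∀ s : G, ∏ q ∈ S.erase p, gfac ρ β q (update U ℓ s) =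
      ∏ q ∈ S.erase p, gfac ρ β q U := fun s =>
    prod_congr rfl fun q hq => gfac_update_of_pcnt_eq_zero ρ β q
      (hlone q (mem_of_mem_erase hq) (ne_of_mem_erase hq)) U s
  have hF : ∀ s : G, polRe ρ 2 (update U ℓ s) (vsite A 0) * polRe ρ 2 (update U ℓ s) (vsite B 0) *
      ∏ q ∈ S, gfac ρ β q (update U ℓ s) =
      (polRe ρ 2 U (vsite A 0) * polRe ρ 2 U (vsite B 0) * ∏ q ∈ S.erase p, gfac ρ β q U) *
        gfac ρ β p (update U ℓ s) := fun s => by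
    rw [polRe_update_of_ccnt_eq_zero ρ A hA, polRe_update_of_ccnt_eq_zero ρ B hB, hsplit, hrest]
    ring
  simp_rw [hF]
  rw [integral_const_mul, hκ U]
  ring

/-- **A lonely link kills the term when the rest vanishes**: under the hypotheses of
`pairTerm_eq_mul_pairTerm_erase`, `T_{S∖{p}}(A,B) = 0` implies `T_S(A,B) = 0`. -/
theorem pairTerm_eq_zero_of_lonely (hρ : Continuous ρ) (hL : 1 < L) {S : Finset (Plaquette 3 L)}
    {p : Plaquette 3 L} (hp : p ∈ S) {ℓ : Edge 3 L} (hℓ : pcnt p ℓ ≠ 0)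
    (hlone : ∀ q ∈ S, q ≠ p → pcnt q ℓ = 0) {A B : ZMod L × ZMod L} (hA : ccnt A ℓ = 0)
    (hB : ccnt B ℓ = 0) (hzero : pairTerm ρ β (S.erase p) A B = 0) : pairTerm ρ β S A B = 0 := by
  obtain ⟨κ, hκ⟩ := pairTerm_eq_mul_pairTerm_erase ρ β hρ hL hp hℓ hlone hA hB
  rw [hκ, hzero, mul_zero]

end Lonely

end DiagRPSUN

end

end Summit.QuantumFields.GaugeBoot
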